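import Summits.SmoothPoincare4.SmoothPoincare4.Theorems.EntropyRungSubcylindricalRecognitionConeAnnulusArithmeticAux
import HarnessLib

/-!
# Gaussian annulus arithmetic in `ℝ⁴` — pointwise and elementary estimates (II)

Helper file for the stub `stub_coneAnnulusArithmetic` of line `ancient-sphere-rigidity`
(crux `EntropyRung.SubcylindricalRecognition`, stmt-SmoothPoincare4-10869), continuing
`…ConeAnnulusArithmeticAux.lean`.

* The three-regime bound for the gradient density of the profile
  `w(s) = e^{-s/8τ} T(s/(2ε²) - 1) T(3 - 4s/r'²)`:
  `16 s w'(s)² ≤ s e^{-s/4τ}/(4τ²) + (32D²/ε² + 2ε²/τ²) · e e^{-s/4ε²}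
    + e^{-r'²/8τ} (512D²/r'² + r'²/2τ²) · e e^{-s/r'²}` for `0 ≤ s ≤ r'²`, `16ε² ≤ r'²`
  (`D` = a bound for `|T'|`): on the bulk `cut' = 0`, on the inner shell `|cut'| ≤ D/(2ε²)`,
  on the outer shell `|cut'| ≤ 4D/r'²` and `e^{-s/4τ} ≤ e^{-r'²/8τ}`; the algebra of the three
  regimes is isolated in `gradDensity_inner_alg`, `gradDensity_bulk_alg`, `gradDensity_outer_alg`.
* "Integrand-ready" forms of all pointwise bounds: every term is `const · e^{-b s}` with an
  explicit `b > 0` (the moment `(s/4τ) e^{-s/4τ}` is traded for the difference quotient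
  `(e^{-(1-t)s/4τ} - e^{-s/4τ})/t` by convexity), so that integration over `ℝ⁴` only needs
  `∫ e^{-b|y|²} dy = π²/b²`.

All statements are [folklore]; no named facts are used.
-/

-- the prescribed namespace `Summit.<P>.<Sub>.…` duplicates `SmoothPoincare4` (P = Sub)
set_option linter.dupNamespace false

noncomputable section

open scoped Topology
open Set Real

namespace Summit.SmoothPoincare4.SmoothPoincare4.Theorems.SubcylindricalRecognition.AncientSphereRigidity

namespace ConeAnnulus

/-! ## The gradient density `16 s w'(s)²` -/

/-- Algebra of the inner shell `s ≤ 4ε²` (there `T'(3 - 4s/r'²) = 0`):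
`16 s w'² ≤ 32D²/ε² + 2ε²/τ²`, dominated by the Gaussian factor `G ≥ 1`. [folklore] -/
theorem gradDensity_inner_alg {s τ ε r' D A₁ A₂ B₁ E₈ E G T₁ T₃ : ℝ} (hτ : 0 < τ) (hε : 0 < ε)
    (hA0 : 0 ≤ A₁ * A₂) (hA1 : A₁ * A₂ ≤ 1) (hA₂0 : 0 ≤ A₂) (hA₂1 : A₂ ≤ 1) (hB : B₁ ^ 2 ≤ D ^ 2)
    (hE : E₈ ^ 2 = E) (hE0 : 0 ≤ E) (hE1 : E ≤ 1) (hs : s ≤ 4 * ε ^ 2) (hG : 1 ≤ G)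
    (hT₁ : 0 ≤ T₁) (hT₃ : 0 ≤ T₃) :
    16 * s * (E₈ * (-1 / (8 * τ)) * (A₁ * A₂) +
        E₈ * (B₁ * (1 / (2 * ε ^ 2)) * A₂ + A₁ * (0 * (-4 / r' ^ 2)))) ^ 2 ≤
      T₁ + (32 * D ^ 2 / ε ^ 2 + 2 * ε ^ 2 / τ ^ 2) * G + T₃ := by
  have hD2 : 0 ≤ D ^ 2 := sq_nonneg D
  have hQ : (E₈ * (-1 / (8 * τ)) * (A₁ * A₂) +
      E₈ * (B₁ * (1 / (2 * ε ^ 2)) * A₂ + A₁ * (0 * (-4 / r' ^ 2)))) ^ 2 =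
      E * (B₁ * A₂ / (2 * ε ^ 2) - A₁ * A₂ / (8 * τ)) ^ 2 := by
    rw [← hE]; ring
  have ha : (A₁ * A₂ / (8 * τ)) ^ 2 ≤ 1 / (64 * τ ^ 2) := by
    rw [div_pow, show (8 * τ) ^ 2 = 64 * τ ^ 2 by ring]
    gcongr; nlinarith
  have hb : (B₁ * A₂ / (2 * ε ^ 2)) ^ 2 ≤ D ^ 2 / (4 * ε ^ 4) := by
    rw [div_pow, show (2 * ε ^ 2) ^ 2 = 4 * ε ^ 4 by ring, mul_pow]
    gcongr
    have := mul_le_mul hB (show A₂ ^ 2 ≤ 1 by nlinarith) (sq_nonneg _) hD2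
    linarith
  have hQ2 : (B₁ * A₂ / (2 * ε ^ 2) - A₁ * A₂ / (8 * τ)) ^ 2 ≤ 1 / (32 * τ ^ 2) + D ^ 2 / (2 * ε ^ 4) := by
    have : (B₁ * A₂ / (2 * ε ^ 2) - A₁ * A₂ / (8 * τ)) ^ 2 ≤
        2 * (A₁ * A₂ / (8 * τ)) ^ 2 + 2 * (B₁ * A₂ / (2 * ε ^ 2)) ^ 2 := by
      nlinarith [sq_nonneg (A₁ * A₂ / (8 * τ) + B₁ * A₂ / (2 * ε ^ 2))]
    have e : 2 * (1 / (64 * τ ^ 2)) + 2 * (D ^ 2 / (4 * ε ^ 4)) = 1 / (32 * τ ^ 2) + D ^ 2 / (2 * ε ^ 4) := by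
      ring
    linarith
  have hM : 0 ≤ 1 / (32 * τ ^ 2) + D ^ 2 / (2 * ε ^ 4) := by positivity
  have hEQ := mul_le_mul hE1 hQ2 (sq_nonneg _) zero_le_one
  have h3 := mul_le_mul hs hEQ (by positivity) (by positivity)
  have e : 4 * ε ^ 2 * (1 * (1 / (32 * τ ^ 2) + D ^ 2 / (2 * ε ^ 4))) =
      (32 * D ^ 2 / ε ^ 2 + 2 * ε ^ 2 / τ ^ 2) / 16 := by
    field_simp
    ring
  rw [e] at h3
  rw [hQ]
  have hK : 0 ≤ 32 * D ^ 2 / ε ^ 2 + 2 * ε ^ 2 / τ ^ 2 := by positivity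
  linarith [mul_le_mul_of_nonneg_left hG hK, h3]

/-- Algebra of the bulk `4ε² < s < r'²/2` (there `cut' = 0`): `16 s w'² ≤ s e^{-s/4τ}/(4τ²)`.
[folklore] -/
theorem gradDensity_bulk_alg {s τ ε r' A₁ A₂ E₈ E T₂ T₃ : ℝ} (hτ : 0 < τ)
    (hA0 : 0 ≤ A₁ * A₂) (hA1 : A₁ * A₂ ≤ 1) (hE : E₈ ^ 2 = E) (hE0 : 0 ≤ E) (hs0 : 0 ≤ s)
    (hT₂ : 0 ≤ T₂) (hT₃ : 0 ≤ T₃) :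
    16 * s * (E₈ * (-1 / (8 * τ)) * (A₁ * A₂) +
        E₈ * (0 * (1 / (2 * ε ^ 2)) * A₂ + A₁ * (0 * (-4 / r' ^ 2)))) ^ 2 ≤
      s * E / (4 * τ ^ 2) + T₂ + T₃ := by
  have hQ : (E₈ * (-1 / (8 * τ)) * (A₁ * A₂) +
      E₈ * (0 * (1 / (2 * ε ^ 2)) * A₂ + A₁ * (0 * (-4 / r' ^ 2)))) ^ 2 =
      E * (A₁ * A₂) ^ 2 / (64 * τ ^ 2) := by
    rw [← hE]; field_simp; ring
  rw [hQ]
  have h1 : (A₁ * A₂) ^ 2 ≤ 1 := by nlinarith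
  have h2 : 16 * s * (E * (A₁ * A₂) ^ 2 / (64 * τ ^ 2)) ≤ 16 * s * (E * 1 / (64 * τ ^ 2)) := by
    gcongr
  have e : 16 * s * (E * 1 / (64 * τ ^ 2)) = s * E / (4 * τ ^ 2) := by
    field_simp; ring
  linarith

/-- Algebra of the outer shell `r'²/2 ≤ s ≤ r'²` (there `T'(s/(2ε²) - 1) = 0` and
`e^{-s/4τ} ≤ e^{-r'²/8τ} =: Eₒ`): `16 s w'² ≤ Eₒ (512D²/r'² + r'²/(2τ²))`, dominated by the
Gaussian factor `G ≥ 1`. [folklore] -/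
theorem gradDensity_outer_alg {s τ ε r' D A₁ A₂ B₂ E₈ E Eo G T₁ T₂ : ℝ} (hτ : 0 < τ) (hr : 0 < r')
    (hA0 : 0 ≤ A₁ * A₂) (hA1 : A₁ * A₂ ≤ 1) (hA₁0 : 0 ≤ A₁) (hA₁1 : A₁ ≤ 1) (hB : B₂ ^ 2 ≤ D ^ 2)
    (hE : E₈ ^ 2 = E) (hE0 : 0 ≤ E) (hEo : E ≤ Eo) (hs : s ≤ r' ^ 2) (hG : 1 ≤ G)
    (hT₁ : 0 ≤ T₁) (hT₂ : 0 ≤ T₂) :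
    16 * s * (E₈ * (-1 / (8 * τ)) * (A₁ * A₂) +
        E₈ * (0 * (1 / (2 * ε ^ 2)) * A₂ + A₁ * (B₂ * (-4 / r' ^ 2)))) ^ 2 ≤
      T₁ + T₂ + Eo * (512 * D ^ 2 / r' ^ 2 + r' ^ 2 / (2 * τ ^ 2)) * G := by
  have hD2 : 0 ≤ D ^ 2 := sq_nonneg D
  have hQ : (E₈ * (-1 / (8 * τ)) * (A₁ * A₂) +
      E₈ * (0 * (1 / (2 * ε ^ 2)) * A₂ + A₁ * (B₂ * (-4 / r' ^ 2)))) ^ 2 =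
      E * (-(4 * (A₁ * B₂) / r' ^ 2) - A₁ * A₂ / (8 * τ)) ^ 2 := by
    rw [← hE]; ring
  have ha : (A₁ * A₂ / (8 * τ)) ^ 2 ≤ 1 / (64 * τ ^ 2) := by
    rw [div_pow, show (8 * τ) ^ 2 = 64 * τ ^ 2 by ring]
    gcongr; nlinarith
  have hb : (-(4 * (A₁ * B₂) / r' ^ 2)) ^ 2 ≤ 16 * D ^ 2 / r' ^ 4 := by
    rw [neg_sq, div_pow, show (r' ^ 2) ^ 2 = r' ^ 4 by ring, mul_pow, mul_pow]
    rw [show 16 * D ^ 2 / r' ^ 4 = 4 ^ 2 * D ^ 2 / r' ^ 4 by norm_num]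
    gcongr 4 ^ 2 * ?_ / _
    have := mul_le_mul (show A₁ ^ 2 ≤ 1 by nlinarith) hB (sq_nonneg _) zero_le_one
    linarith
  have hQ2 : (-(4 * (A₁ * B₂) / r' ^ 2) - A₁ * A₂ / (8 * τ)) ^ 2 ≤
      1 / (32 * τ ^ 2) + 32 * D ^ 2 / r' ^ 4 := by
    have : (-(4 * (A₁ * B₂) / r' ^ 2) - A₁ * A₂ / (8 * τ)) ^ 2 ≤
        2 * (A₁ * A₂ / (8 * τ)) ^ 2 + 2 * (-(4 * (A₁ * B₂) / r' ^ 2)) ^ 2 := by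
      nlinarith [sq_nonneg (A₁ * A₂ / (8 * τ) + -(4 * (A₁ * B₂) / r' ^ 2))]
    have e : 2 * (1 / (64 * τ ^ 2)) + 2 * (16 * D ^ 2 / r' ^ 4) = 1 / (32 * τ ^ 2) + 32 * D ^ 2 / r' ^ 4 := by
      ring
    linarith
  have hM : 0 ≤ 1 / (32 * τ ^ 2) + 32 * D ^ 2 / r' ^ 4 := by positivity
  have hEQ := mul_le_mul hEo hQ2 (sq_nonneg _) (hE0.trans hEo)
  have h3 := mul_le_mul hs hEQ (by positivity) (by positivity)
  have e : r' ^ 2 * (Eo * (1 / (32 * τ ^ 2) + 32 * D ^ 2 / r' ^ 4)) =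
      Eo * (512 * D ^ 2 / r' ^ 2 + r' ^ 2 / (2 * τ ^ 2)) / 16 := by
    field_simp
    ring
  rw [e] at h3
  rw [hQ]
  have hK : 0 ≤ Eo * (512 * D ^ 2 / r' ^ 2 + r' ^ 2 / (2 * τ ^ 2)) := by
    have : 0 ≤ Eo := hE0.trans hEo
    positivity
  linarith [mul_le_mul_of_nonneg_left hG hK, h3]

/-- Three-regime bound for the gradient density: on the bulk `cut' = 0` and
`16 s w'² ≤ s e^{-s/4τ}/(4τ²)`; on the inner shell `s ≤ 4ε²` one has `|cut'| ≤ D/(2ε²)`, on the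
outer shell `r'²/2 ≤ s ≤ r'²` one has `|cut'| ≤ 4D/r'²` and `e^{-s/4τ} ≤ e^{-r'²/8τ}`; the shell
indicators are dominated by the Gaussians `e · e^{-s/(4ε²)}` and `e · e^{-s/r'²}`. [folklore] -/
theorem gradDensity_le {D τ ε r' s : ℝ} (hD : ∀ x, |deriv smoothTransition x| ≤ D)
    (hτ : 0 < τ) (hε : 0 < ε) (hr : 0 < r') (hεr : 16 * ε ^ 2 ≤ r' ^ 2) (hs : 0 ≤ s)
    (hsr : s ≤ r' ^ 2) :
    16 * s * (deriv (fun s : ℝ ↦ exp (-s / (8 * τ)) *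
        (smoothTransition (s / (2 * ε ^ 2) - 1) * smoothTransition (3 - 4 * s / r' ^ 2))) s) ^ 2 ≤
      s * exp (-s / (4 * τ)) / (4 * τ ^ 2) +
        (32 * D ^ 2 / ε ^ 2 + 2 * ε ^ 2 / τ ^ 2) * (exp 1 * exp (-s / (4 * ε ^ 2))) +
        exp (-r' ^ 2 / (8 * τ)) * (512 * D ^ 2 / r' ^ 2 + r' ^ 2 / (2 * τ ^ 2)) *
          (exp 1 * exp (-s / r' ^ 2)) := by
  rw [(hasDerivAt_profile τ ε r' s).deriv]
  have hA₁0 : 0 ≤ smoothTransition (s / (2 * ε ^ 2) - 1) := smoothTransition.nonneg _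
  have hA₁1 : smoothTransition (s / (2 * ε ^ 2) - 1) ≤ 1 := smoothTransition.le_one _
  have hA₂0 : 0 ≤ smoothTransition (3 - 4 * s / r' ^ 2) := smoothTransition.nonneg _
  have hA₂1 : smoothTransition (3 - 4 * s / r' ^ 2) ≤ 1 := smoothTransition.le_one _
  obtain ⟨hA0, hA1⟩ := cut_mem_Icc ε r' s
  have hB₁D : deriv smoothTransition (s / (2 * ε ^ 2) - 1) ^ 2 ≤ D ^ 2 := by
    have := hD (s / (2 * ε ^ 2) - 1)
    exact sq_le_sq' (abs_le.mp this).1 (abs_le.mp this).2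
  have hB₂D : deriv smoothTransition (3 - 4 * s / r' ^ 2) ^ 2 ≤ D ^ 2 := by
    have := hD (3 - 4 * s / r' ^ 2)
    exact sq_le_sq' (abs_le.mp this).1 (abs_le.mp this).2
  have hE := exp_neg_div_eight_sq τ s
  have hE0 := (exp_pos (-s / (4 * τ))).le
  have hE1 : exp (-s / (4 * τ)) ≤ 1 := by
    rw [exp_le_one_iff, div_nonpos_iff]; right; constructor <;> nlinarith
  -- the three terms on the right are nonnegative
  have hT1 : 0 ≤ s * exp (-s / (4 * τ)) / (4 * τ ^ 2) := by positivity
  have hT2 : 0 ≤ (32 * D ^ 2 / ε ^ 2 + 2 * ε ^ 2 / τ ^ 2) * (exp 1 * exp (-s / (4 * ε ^ 2))) := by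
    positivity
  have hT3 : 0 ≤ exp (-r' ^ 2 / (8 * τ)) * (512 * D ^ 2 / r' ^ 2 + r' ^ 2 / (2 * τ ^ 2)) *
      (exp 1 * exp (-s / r' ^ 2)) := by positivity
  have hr2 : 0 < r' ^ 2 := by positivity
  rcases le_or_gt s (4 * ε ^ 2) with h1 | h1
  · -- inner shell
    have hB₂0 : deriv smoothTransition (3 - 4 * s / r' ^ 2) = 0 := by
      apply deriv_smoothTransition_of_one_lt
      have : 4 * s / r' ^ 2 < 2 := by rw [div_lt_iff₀ hr2]; nlinarith
      linarith
    have hG : 1 ≤ exp 1 * exp (-s / (4 * ε ^ 2)) := by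
      rw [← exp_add]
      apply one_le_exp
      have : s / (4 * ε ^ 2) ≤ 1 := by rw [div_le_one (by positivity)]; exact h1
      have e : -s / (4 * ε ^ 2) = -(s / (4 * ε ^ 2)) := by ring
      rw [e]; linarith
    rw [hB₂0]
    exact gradDensity_inner_alg hτ hε hA0 hA1 hA₂0 hA₂1 hB₁D hE hE0 hE1 h1 hG hT1 hT3
  rcases lt_or_ge s (r' ^ 2 / 2) with h2 | h2
  · -- bulk
    have hB₁0 : deriv smoothTransition (s / (2 * ε ^ 2) - 1) = 0 := by
      apply deriv_smoothTransition_of_one_lt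
      rw [lt_sub_iff_add_lt, lt_div_iff₀ (by positivity)]; linarith
    have hB₂0 : deriv smoothTransition (3 - 4 * s / r' ^ 2) = 0 := by
      apply deriv_smoothTransition_of_one_lt
      have : 4 * s / r' ^ 2 < 2 := by rw [div_lt_iff₀ hr2]; nlinarith
      linarith
    rw [hB₁0, hB₂0]
    exact gradDensity_bulk_alg hτ hA0 hA1 hE hE0 hs hT2 hT3
  · -- outer shell
    have hB₁0 : deriv smoothTransition (s / (2 * ε ^ 2) - 1) = 0 := by
      apply deriv_smoothTransition_of_one_lt
      rw [lt_sub_iff_add_lt, lt_div_iff₀ (by positivity)]; nlinarith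
    have hG : 1 ≤ exp 1 * exp (-s / r' ^ 2) := by
      rw [← exp_add]
      apply one_le_exp
      have : s / r' ^ 2 ≤ 1 := by rw [div_le_one hr2]; exact hsr
      have e : -s / r' ^ 2 = -(s / r' ^ 2) := by ring
      rw [e]; linarith
    have hEo : exp (-s / (4 * τ)) ≤ exp (-r' ^ 2 / (8 * τ)) := by
      rw [exp_le_exp]
      have e : -r' ^ 2 / (8 * τ) - -s / (4 * τ) = (2 * s - r' ^ 2) / (8 * τ) := by
        field_simp
        ring
      have : 0 ≤ (2 * s - r' ^ 2) / (8 * τ) := div_nonneg (by linarith) (by positivity)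
      linarith
    rw [hB₁0]
    exact gradDensity_outer_alg hτ hr hA0 hA1 hA₁0 hA₁1 hB₂D hE hE0 hEo hsr hG hT1 hT2

/-! ## Integrand-ready forms: every term is `const · e^{-b s}` -/

/-- The Gaussian moment traded for a difference quotient:
`(s/4τ) e^{-s/4τ} ≤ (e^{-(1-t)s/4τ} - e^{-s/4τ})/t` for `t > 0`. [folklore] -/
theorem moment_le {t τ : ℝ} (ht : 0 < t) (s : ℝ) :
    s / (4 * τ) * exp (-(1 / (4 * τ)) * s) ≤
      (exp (-((1 - t) / (4 * τ)) * s) - exp (-(1 / (4 * τ)) * s)) / t := by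
  have h := mul_mul_exp_neg_le_sub (1 / (4 * τ)) (t / (4 * τ)) s
  have e : 1 / (4 * τ) - t / (4 * τ) = (1 - t) / (4 * τ) := by ring
  rw [e] at h
  rw [le_div_iff₀ ht]
  have e2 : s / (4 * τ) * exp (-(1 / (4 * τ)) * s) * t =
      t / (4 * τ) * (s * exp (-(1 / (4 * τ)) * s)) := by ring
  rw [e2]; exact h

/-- `w² ≤ e^{-s/4τ}`, integrand-ready. [folklore] -/
theorem profile_sq_le' (τ ε r' s : ℝ) :
    (exp (-s / (8 * τ)) *
        (smoothTransition (s / (2 * ε ^ 2) - 1) * smoothTransition (3 - 4 * s / r' ^ 2))) ^ 2 ≤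
      exp (-(1 / (4 * τ)) * s) := by
  have e : -(1 / (4 * τ)) * s = -s / (4 * τ) := by ring
  rw [e]; exact profile_sq_le τ ε r' s

/-- `e^{-s/4τ} - e e^{-s/4ε²} - e^{-r'²/16τ} e^{-s/8τ} ≤ w²`, integrand-ready. [folklore] -/
theorem profile_sq_ge' {τ ε r' s : ℝ} (hτ : 0 < τ) (hε : 0 < ε) (hr : 0 < r') (hs : 0 ≤ s) :
    exp (-(1 / (4 * τ)) * s) - exp 1 * exp (-(1 / (4 * ε ^ 2)) * s) -
        exp (-r' ^ 2 / (16 * τ)) * exp (-(1 / (8 * τ)) * s) ≤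
      (exp (-s / (8 * τ)) *
        (smoothTransition (s / (2 * ε ^ 2) - 1) * smoothTransition (3 - 4 * s / r' ^ 2))) ^ 2 := by
  have e1 : -(1 / (4 * τ)) * s = -s / (4 * τ) := by ring
  have e2 : -(1 / (4 * ε ^ 2)) * s = -s / (4 * ε ^ 2) := by ring
  have e3 : -(1 / (8 * τ)) * s = -s / (8 * τ) := by ring
  rw [e1, e2, e3]; exact profile_sq_ge hτ hε hr hs

/-- `-w² log w² ≤ (e^{-(1-t)s/4τ} - e^{-s/4τ})/t + e e^{-s/4ε²} + e^{-r'²/16τ} e^{-s/8τ}`,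
integrand-ready. [folklore] -/
theorem negMulLog_profile_sq_le' {t τ ε r' s : ℝ} (ht : 0 < t) (hτ : 0 < τ) (hε : 0 < ε)
    (hr : 0 < r') (hs : 0 ≤ s) :
    -((exp (-s / (8 * τ)) *
          (smoothTransition (s / (2 * ε ^ 2) - 1) * smoothTransition (3 - 4 * s / r' ^ 2))) ^ 2 *
        log ((exp (-s / (8 * τ)) *
          (smoothTransition (s / (2 * ε ^ 2) - 1) * smoothTransition (3 - 4 * s / r' ^ 2))) ^ 2)) ≤
      (exp (-((1 - t) / (4 * τ)) * s) - exp (-(1 / (4 * τ)) * s)) / t +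
        exp 1 * exp (-(1 / (4 * ε ^ 2)) * s) +
        exp (-r' ^ 2 / (16 * τ)) * exp (-(1 / (8 * τ)) * s) := by
  have h := negMulLog_profile_sq_le hτ hε hr hs
  have hm := moment_le (τ := τ) ht s
  have e1 : -(1 / (4 * τ)) * s = -s / (4 * τ) := by ring
  have e2 : -(1 / (4 * ε ^ 2)) * s = -s / (4 * ε ^ 2) := by ring
  have e3 : -(1 / (8 * τ)) * s = -s / (8 * τ) := by ring
  rw [e1] at hm ⊢
  rw [e2, e3]
  linarith

/-- The gradient density bound, integrand-ready:
`16 s w'² ≤ τ⁻¹ (e^{-(1-t)s/4τ} - e^{-s/4τ})/t + K₁ · e e^{-s/4ε²} + K₂ · e e^{-s/r'²}`. [folklore] -/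
theorem gradDensity_le' {D t τ ε r' s : ℝ} (hD : ∀ x, |deriv smoothTransition x| ≤ D)
    (ht : 0 < t) (hτ : 0 < τ) (hε : 0 < ε) (hr : 0 < r') (hεr : 16 * ε ^ 2 ≤ r' ^ 2) (hs : 0 ≤ s)
    (hsr : s ≤ r' ^ 2) :
    16 * s * (deriv (fun s : ℝ ↦ exp (-s / (8 * τ)) *
        (smoothTransition (s / (2 * ε ^ 2) - 1) * smoothTransition (3 - 4 * s / r' ^ 2))) s) ^ 2 ≤
      1 / τ * ((exp (-((1 - t) / (4 * τ)) * s) - exp (-(1 / (4 * τ)) * s)) / t) +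
        (32 * D ^ 2 / ε ^ 2 + 2 * ε ^ 2 / τ ^ 2) * (exp 1 * exp (-(1 / (4 * ε ^ 2)) * s)) +
        exp (-r' ^ 2 / (8 * τ)) * (512 * D ^ 2 / r' ^ 2 + r' ^ 2 / (2 * τ ^ 2)) *
          (exp 1 * exp (-(1 / r' ^ 2) * s)) := by
  have h := gradDensity_le hD hτ hε hr hεr hs hsr
  have hm := moment_le (τ := τ) ht s
  have e1 : -(1 / (4 * τ)) * s = -s / (4 * τ) := by ring
  have e2 : -(1 / (4 * ε ^ 2)) * s = -s / (4 * ε ^ 2) := by ring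
  have e4 : -(1 / r' ^ 2) * s = -s / r' ^ 2 := by ring
  rw [e1] at hm ⊢
  rw [e2, e4]
  have e5 : s * exp (-s / (4 * τ)) / (4 * τ ^ 2) = 1 / τ * (s / (4 * τ) * exp (-s / (4 * τ))) := by
    field_simp
  rw [e5] at h
  have := mul_le_mul_of_nonneg_left hm (show 0 ≤ 1 / τ by positivity)
  linarith

end ConeAnnulus

/-- **Registered sub-goal `stub_coneAnnulusGradDensity`** of `stub_coneAnnulusArithmetic`: the
three-regime bound for the gradient density `16 s w'(s)²`. [folklore] -/
theorem stub_coneAnnulusGradDensity :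
    ∀ (D τ ε r' s : ℝ), (∀ x : ℝ, |deriv Real.smoothTransition x| ≤ D) → 0 < τ → 0 < ε → 0 < r' →
      16 * ε ^ 2 ≤ r' ^ 2 → 0 ≤ s → s ≤ r' ^ 2 →
      16 * s * (deriv (fun s : ℝ ↦ Real.exp (-s / (8 * τ)) *
          (Real.smoothTransition (s / (2 * ε ^ 2) - 1) *
            Real.smoothTransition (3 - 4 * s / r' ^ 2))) s) ^ 2 ≤
        s * Real.exp (-s / (4 * τ)) / (4 * τ ^ 2) +
          (32 * D ^ 2 / ε ^ 2 + 2 * ε ^ 2 / τ ^ 2) * (Real.exp 1 * Real.exp (-s / (4 * ε ^ 2))) +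
          Real.exp (-r' ^ 2 / (8 * τ)) * (512 * D ^ 2 / r' ^ 2 + r' ^ 2 / (2 * τ ^ 2)) *
            (Real.exp 1 * Real.exp (-s / r' ^ 2)) :=
  fun _ _ _ _ _ hD hτ hε hr hεr hs hsr ↦ ConeAnnulus.gradDensity_le hD hτ hε hr hεr hs hsr

end Summit.SmoothPoincare4.SmoothPoincare4.Theorems.SubcylindricalRecognition.AncientSphereRigidity
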